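import Mathlib
import Summits.Ventures.PercRepro.TriangleCapBandGen

/-!
# PercRepro — THE BASE ROWS `r = 1, 2, 3, 4` OF EVERY ROW `a ≥ 4` ON EVERY VERTEX TYPE (p3, gen 40; part 160)

The sub-diagonals `r ≤ 4` of the row `a` (`m = a (k − a) − r`, `2a + 4 ≤ k`), landed in gens 34–40 with
bipartition / product / density hypotheses, restated uniformly: `band_row_base (a r) (ha : 4 ≤ a)
(hr1 : 1 ≤ r) (hr4 : r ≤ 4) (hk : 2a + 4 ≤ k) (hm : m + a² + r = a k) : Σ_v d(v)² + r (k − 1 − r) ≤ m k` —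
the base of the induction of part 161. Rows `1, 2, 3` are parts 120 / 124 / 130 with the products
`a (k − a) − 4 … − 1` (`products_avoid_cell`); row `4` is part 155 for `a = 4`, the cell `(14, 41)` for `a = 5`
at `k = 14`, and the `k ≥ 13` assembly of part 129 with a vacuous one-triangle residue on the dense cells
(`8k ≤ 2m + 28`, `row_four_dense_arith`). Axioms: standard.
-/

namespace PercRepro

namespace TriangleCap

namespace C047

open Finset

variable {V : Type*} [Fintype V] [DecidableEq V]

/-- The numbers `m, …, m + r − 1` of the cell `m = a (k − a) − r` (`1 ≤ r ≤ 4`, `2a + 4 ≤ k`) are not products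
`a′ (k − a′)`. -/
theorem products_avoid_cell (k a r m : ℕ) (ha : 1 ≤ a) (hak : 2 * a + 4 ≤ k) (hr1 : 1 ≤ r) (hr4 : r ≤ 4)
    (hm : m + a * a + r = a * k) : ∀ a', a' ≤ k → ∀ i, i + 1 ≤ r → m + i ≠ a' * (k - a') := by
  intro a' ha' i hi
  obtain ⟨h1, h2, h3, h4⟩ := products_avoid k a ha hak a' ha'
  obtain ⟨c, hc⟩ : ∃ c, k = a + c := ⟨k - a, by omega⟩
  have e : a * (k - a) = a * c := by rw [hc, Nat.add_sub_cancel_left]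
  have hm' : m + r = a * c := by
    rw [hc] at hm
    nlinarith [hm]
  rw [e] at h1 h2 h3 h4
  have : r - i = 1 ∨ r - i = 2 ∨ r - i = 3 ∨ r - i = 4 := by omega
  rcases this with h | h | h | h
  · have e' : m + i = a * c - 1 := by omega
    rw [e']; exact h4
  · have e' : m + i = a * c - 2 := by omega
    rw [e']; exact h3
  · have e' : m + i = a * c - 3 := by omega
    rw [e']; exact h2
  · have e' : m + i = a * c - 4 := by omega
    rw [e']; exact h1

/-- The density of the cells `m = a (k − a) − r` (`a ≥ 4`, `r ≤ 4`, `2a + 4 ≤ k`): `4k ≤ m + 20`. -/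
theorem row_arith (a k m r : ℕ) (ha : 4 ≤ a) (hk : 2 * a + 4 ≤ k) (hr : r ≤ 4) (hm : m + a * a + r = a * k) :
    4 * k ≤ m + 20 := by
  obtain ⟨a', rfl⟩ : ∃ a', a = a' + 4 := ⟨a - 4, by omega⟩
  obtain ⟨c, rfl⟩ : ∃ c, k = 2 * (a' + 4) + 4 + c := ⟨k - (2 * (a' + 4) + 4), by omega⟩
  nlinarith [hm]

/-- The dense cells of the row `4` (`a ≥ 5`, `k ≥ 15`): `8k ≤ 2m + 28`, so the one-triangle residue is vacuous. -/
theorem row_four_dense_arith (a k m : ℕ) (ha : 5 ≤ a) (hk : 2 * a + 4 ≤ k) (hk15 : 15 ≤ k)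
    (hm : m + a * a + 4 = a * k) : 8 * k ≤ 2 * m + 28 := by
  obtain ⟨a', rfl⟩ : ∃ a', a = a' + 5 := ⟨a - 5, by omega⟩
  obtain ⟨c, rfl⟩ : ∃ c, k = 2 * (a' + 5) + 4 + c := ⟨k - (2 * (a' + 5) + 4), by omega⟩
  nlinarith [hm]

/-- **THE ROW `r = 1`** of every row `a ≥ 4` (`2a + 4 ≤ k`): `Σ_v d(v)² + (k − 2) ≤ m k`. -/
theorem band_row_one (D : SimpleGraph V) [DecidableRel D.Adj] (hK : K4mFree D) (a : ℕ) (ha : 4 ≤ a)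
    (hk : 2 * a + 4 ≤ Fintype.card V) (hm : D.edgeFinset.card + a * a + 1 = a * Fintype.card V) :
    ∑ v, deg D v * deg D v + (Fintype.card V - 2) ≤ D.edgeFinset.card * Fintype.card V := by
  have h4 := row_arith a (Fintype.card V) D.edgeFinset.card 1 ha hk (by norm_num) hm
  apply dense_stability_eight D hK (by omega) (by omega)
  rintro ⟨A, hA⟩
  have h := card_edges_eq_of_complete_bipartite D A hA
  have hXk : A.card ≤ Fintype.card V := card_le_univ A
  have := products_avoid_cell (Fintype.card V) a 1 D.edgeFinset.card (by omega) hk (by norm_num) (by norm_num) hm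
    A.card hXk 0 (by norm_num)
  rw [add_zero] at this
  exact this h

/-- **THE ROW `r = 4`** of every row `a ≥ 5` (`2a + 4 ≤ k`): `Σ_v d(v)² + 4 (k − 5) ≤ m k`. -/
theorem band_row_four_of_five (D : SimpleGraph V) [DecidableRel D.Adj] (hK : K4mFree D) (a : ℕ) (ha : 5 ≤ a)
    (hk : 2 * a + 4 ≤ Fintype.card V) (hm : D.edgeFinset.card + a * a + 4 = a * Fintype.card V) :
    ∑ v, deg D v * deg D v + 4 * (Fintype.card V - 5) ≤ D.edgeFinset.card * Fintype.card V := by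
  have h4 := row_arith a (Fintype.card V) D.edgeFinset.card 4 (by omega) hk (by norm_num) hm
  have hprod : ∀ a', a' ≤ Fintype.card V → D.edgeFinset.card ≠ a' * (Fintype.card V - a') ∧
      D.edgeFinset.card + 1 ≠ a' * (Fintype.card V - a') ∧ D.edgeFinset.card + 2 ≠ a' * (Fintype.card V - a') ∧
      D.edgeFinset.card + 3 ≠ a' * (Fintype.card V - a') := by
    intro a' ha'
    have h := products_avoid_cell (Fintype.card V) a 4 D.edgeFinset.card (by omega) hk (by norm_num)
      (by norm_num) hm a' ha'
    refine ⟨?_, h 1 (by norm_num), h 2 (by norm_num), h 3 (by norm_num)⟩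
    have := h 0 (by norm_num)
    rwa [add_zero] at this
  rcases Nat.lt_or_ge (Fintype.card V) 15 with h14 | h15
  · -- `a = 5`, `k = 14`: the cell `(14, 41)`
    have ha5 : a = 5 := by omega
    subst ha5
    exact dense_stability_four_fourteen_fortyone D hK (by omega) (by omega)
  · have h8 := row_four_dense_arith a (Fintype.card V) D.edgeFinset.card ha hk h15 hm
    apply dense_stability_four_modulo_few_outer D hK (by omega) (by omega) hprod
    intro u v w _ _ _ _ _ hpay _
    omega

/-- **THE BASE ROWS `r = 1, 2, 3, 4` OF EVERY ROW `a ≥ 4`** (`2a + 4 ≤ k`): `m + a² + r = a k` ⇒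
`Σ_v d(v)² + r (k − 1 − r) ≤ m k`. -/
theorem band_row_base (D : SimpleGraph V) [DecidableRel D.Adj] (hK : K4mFree D) (a r : ℕ) (ha : 4 ≤ a)
    (hr1 : 1 ≤ r) (hr4 : r ≤ 4) (hk : 2 * a + 4 ≤ Fintype.card V)
    (hm : D.edgeFinset.card + a * a + r = a * Fintype.card V) :
    ∑ v, deg D v * deg D v + r * (Fintype.card V - 1 - r) ≤ D.edgeFinset.card * Fintype.card V := by
  have h4 := row_arith a (Fintype.card V) D.edgeFinset.card r ha hk hr4 hm
  have hprod : ∀ a', a' ≤ Fintype.card V → ∀ i, i + 1 ≤ r → D.edgeFinset.card + i ≠ a' * (Fintype.card V - a') :=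
    products_avoid_cell (Fintype.card V) a r D.edgeFinset.card (by omega) hk hr1 hr4 hm
  interval_cases r
  · have := band_row_one D hK a ha hk hm
    have e : Fintype.card V - 1 - 1 = Fintype.card V - 2 := by omega
    rw [e]
    omega
  · have := dense_stability_two_of_ten D hK (by omega) (by omega)
      (not_bip_of_card_eq D (Fintype.card V) D.edgeFinset.card 1 rfl rfl
        (fun a' ha' i hi => hprod a' ha' i (by omega)))
    have e : Fintype.card V - 1 - 2 = Fintype.card V - 3 := by omega
    rw [e]
    exact this
  · have := dense_stability_three_of_ten D hK (by omega) (by omega) (by omega) (Or.inl (by omega))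
      (not_bip_of_card_eq D (Fintype.card V) D.edgeFinset.card 2 rfl rfl
        (fun a' ha' i hi => hprod a' ha' i (by omega)))
    have e : Fintype.card V - 1 - 3 = Fintype.card V - 4 := by omega
    rw [e]
    exact this
  · have e : Fintype.card V - 1 - 4 = Fintype.card V - 5 := by omega
    rw [e]
    rcases Nat.lt_or_ge a 5 with h4' | h5
    · have ha4 : a = 4 := by omega
      subst ha4
      exact four_row_base D hK 4 (by norm_num) (by norm_num) (by omega) (by omega)
    · exact band_row_four_of_five D hK a h5 hk hm

end C047

end TriangleCap

end PercRepro
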